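import Summits.QuantumFields.YangMills.Theorems.PoincareLipschitzSphereRayProjection
import Summits.QuantumFields.YangMills.Theorems.PoincareLipschitzProjectionAveraging
import Literature.MathematicalPhysics.QuantumFieldTheory.Balaban1983to89.B4Eq19LatticeOperators
import HarnessLib

/-!
# Crux `HistoryTailL` (stmt-QuantumFields-19936), K2 organ `hImproveCoreFlat`, road R1 — FILE H-3 «B2′: THE LATTICE LUCKHAUS LEMMA FOR
# `S³`-VALUED MAPS, GEOMETRY-FREE» — two unit lattice maps `u, v : ℤ³ → S³ ⊂ ℝ⁴` and ANY cutoff `t : ℤ³ → [0,1]` admit a UNIT lattice map `w`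
# with `w = u` on `{t = 0}`, `w = v` on `{t = 1}` and, on every finite bond set,
# `Σ ‖δw‖² ≤ C·Σ (‖δu‖² + ‖δv‖² + (δt)²‖u − v‖²)` — universal `C`, NO smallness proviso

Cell `ym3-torus` (YM ladder rung R3 = continuum SU(2) Yang–Mills on T³ — a RUNG, NOT the Clay problem: not d = 4, not infinite volume, not a mass
gap); TWIN-WIDTH helper seat `ym-ust-19936-w7` g13.  Helper `--supports stmt-QuantumFields-19936`; THEOREMS ONLY (0 `def`, 0 `sorry`, default
heartbeats); `Zd 3` letters of lit ✓`B4Eq19LatticeOperators`.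

WHY (LEAD ★w1-19936 g9 ORGAN memo `ORGAN-hImproveCoreFlat-w1g9.md` §4, brick B2 «DISCRETE LUCKHAUS LEMMA», and w8 g7 LOCATE v1.8 §11 (Γ3)∕§13).
Road R1 for the organ (blow-down + compactness + SU84 on the limit) needs, on the lattice side, an interpolation lemma gluing an almost-minimiser to a
comparison map across a transition layer with energy `≲` layer energies `+ (mismatch)²∕thickness²`, the glued map staying `S³`-valued.  Luckhaus'
construction (skeleton of a grid on the sphere, 1D Sobolev, cone fillings) needs small oscillation to project back to the sphere and lattice-sphere
geometry; for SPHERE targets the Hardt–Kinderlehrer–Lin device does it with NO geometry and NO smallness: interpolate linearly,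
`w̃ := (1 − t)u + t v` (`‖w̃‖ ≤ 1`), and compose with the ray projection `π_p` from a centre `p ∈ B_{1∕2}` (H-1: `π_p` fixes `S³`, so the boundary
conditions hold for EVERY `p`; `‖π_p y − π_p z‖² ≤ 36‖y − z‖²∕‖y − p‖²`), choosing `p` by the average of H-2 (`Σ c_e‖q_e − p‖⁻² ≤ KΣ c_e`,
`p` off the countable range of `w̃` so that `w̃ ≠ p` at every site).  Bond by bond
`w̃(y′) − w̃(y) = (1 − t y′)(u y′ − u y) + t y′ (v y′ − v y) + (t y′ − t y)(v y − u y)`, whence `‖δw̃‖² ≤ 3(‖δu‖² + ‖δv‖² + (δt)²‖u − v‖²)`.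

WHAT IS PROVED (ns `…Theorems.PoincareLipschitzLatticeLuckhausHKL`).
* §1 `convex_sub_convex_eq` (the bond identity above), `norm_convex_le_one`, ★`norm_sub_sq_convex_le`
  (`‖δw̃‖² ≤ 3(‖δu‖² + ‖δv‖² + (δt)²‖u − v‖²)`).
* §2 ★★★ `exists_unit_interpolant` — B2′ as displayed in the title, `C = 108·K` with `K` the averaging constant of H-2.
HONEST SCOPE.  One brick (B2) of road R1; bricks B3 (compactness ∕ interpolation package) and B5 (SU84 as a Literature fact) remain, and NOTHING here
proves `hImproveCoreFlat`, K1, `MeanDeviationL`, `BlockLipschitzL` or `HistoryTailL`.  YM₃ on T³ is rung R3, not Clay; YM gap NOT proved; no summit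
statement is proved here.

References: R. Hardt, D. Kinderlehrer, F.-H. Lin, Comm. Math. Phys. 105 (1986) 547–570 [HardtKinderlehrerLin1986] (§2); S. Luckhaus, Indiana Univ.
Math. J. 37 (1988) 349–367 (Lemma 1); L. Simon, Theorems on Regularity and Singularity of Energy Minimizing Maps (1996) §2.6.
-/

set_option autoImplicit false

noncomputable section

open scoped BigOperators InnerProductSpace
open RealInnerProductSpace Finset

namespace Summit.QuantumFields.YangMills.Theorems.PoincareLipschitzLatticeLuckhausHKL

open Literature.MathematicalPhysics.QuantumFieldTheory.Balaban1983to89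
open B4Eq19LatticeOperators (Zd unitVec)
open Summit.QuantumFields.YangMills.Theorems.PoincareLipschitzSphereRayProjection
  (norm_rayProj_eq_one rayProj_eq_self_of_norm_eq_one norm_rayProj_sub_rayProj_sq_le)
open Summit.QuantumFields.YangMills.Theorems.PoincareLipschitzProjectionAveraging (exists_centre_weighted_le)

/-! ## §1 The linear interpolant `w̃ = (1 − t)u + t v`: bond identity and the factor-3 bound -/

/-- The bond identity of the linear interpolant:
`w̃(y′) − w̃(y) = (1 − t′)(u′ − u) + t′(v′ − v) + (t′ − t)(v − u)`. [folklore] -/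
theorem convex_sub_convex_eq {V : Type*} [AddCommGroup V] [Module ℝ V] (u u' v v' : V) (t t' : ℝ) :
    ((1 - t') • u' + t' • v') - ((1 - t) • u + t • v) =
      (1 - t') • (u' - u) + t' • (v' - v) + (t' - t) • (v - u) := by
  simp only [smul_sub, sub_smul, one_smul]
  abel

/-- A convex combination of two unit vectors lies in the closed unit ball. [folklore] -/
theorem norm_convex_le_one {V : Type*} [NormedAddCommGroup V] [NormedSpace ℝ V] (u v : V) (t : ℝ)
    (hu : ‖u‖ = 1) (hv : ‖v‖ = 1) (h0 : 0 ≤ t) (h1 : t ≤ 1) : ‖(1 - t) • u + t • v‖ ≤ 1 := by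
  calc ‖(1 - t) • u + t • v‖ ≤ ‖(1 - t) • u‖ + ‖t • v‖ := norm_add_le _ _
    _ = (1 - t) * 1 + t * 1 := by
        rw [norm_smul, norm_smul, hu, hv, Real.norm_of_nonneg (by linarith), Real.norm_of_nonneg h0]
    _ = 1 := by ring

/-- ★ THE FACTOR-3 BOUND for the linear interpolant of lattice maps along a bond (`0 ≤ t′ ≤ 1`):
`‖w̃(y′) − w̃(y)‖² ≤ 3(‖u′ − u‖² + ‖v′ − v‖² + (t′ − t)²‖u − v‖²)`. [folklore] -/
theorem norm_sub_sq_convex_le {V : Type*} [NormedAddCommGroup V] [NormedSpace ℝ V] (u u' v v' : V) (t t' : ℝ)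
    (h0 : 0 ≤ t') (h1 : t' ≤ 1) :
    ‖((1 - t') • u' + t' • v') - ((1 - t) • u + t • v)‖ ^ 2 ≤
      3 * (‖u' - u‖ ^ 2 + ‖v' - v‖ ^ 2 + (t' - t) ^ 2 * ‖u - v‖ ^ 2) := by
  rw [convex_sub_convex_eq]
  have hle : ‖(1 - t') • (u' - u) + t' • (v' - v) + (t' - t) • (v - u)‖ ≤
      ‖u' - u‖ + ‖v' - v‖ + |t' - t| * ‖u - v‖ := by
    calc _ ≤ ‖(1 - t') • (u' - u) + t' • (v' - v)‖ + ‖(t' - t) • (v - u)‖ := norm_add_le _ _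
      _ ≤ ‖(1 - t') • (u' - u)‖ + ‖t' • (v' - v)‖ + ‖(t' - t) • (v - u)‖ := by
          linarith [norm_add_le ((1 - t') • (u' - u)) (t' • (v' - v))]
      _ = (1 - t') * ‖u' - u‖ + t' * ‖v' - v‖ + |t' - t| * ‖u - v‖ := by
          rw [norm_smul, norm_smul, norm_smul, Real.norm_of_nonneg (by linarith), Real.norm_of_nonneg h0,
            Real.norm_eq_abs, norm_sub_rev v u]
      _ ≤ ‖u' - u‖ + ‖v' - v‖ + |t' - t| * ‖u - v‖ := by
          nlinarith [norm_nonneg (u' - u), norm_nonneg (v' - v)]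
  have h0' : 0 ≤ ‖(1 - t') • (u' - u) + t' • (v' - v) + (t' - t) • (v - u)‖ := norm_nonneg _
  calc _ ≤ (‖u' - u‖ + ‖v' - v‖ + |t' - t| * ‖u - v‖) ^ 2 := pow_le_pow_left₀ h0' hle 2
    _ ≤ 3 * (‖u' - u‖ ^ 2 + ‖v' - v‖ ^ 2 + (|t' - t| * ‖u - v‖) ^ 2) := by
        -- `(p + q + r)² ≤ 3(p² + q² + r²)` inline (the named form is lit ✓`MatomakiRadziwillL14.sq_add_three_le`)
        nlinarith [sq_nonneg (‖u' - u‖ - ‖v' - v‖), sq_nonneg (‖v' - v‖ - |t' - t| * ‖u - v‖),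
          sq_nonneg (‖u' - u‖ - |t' - t| * ‖u - v‖)]
    _ = 3 * (‖u' - u‖ ^ 2 + ‖v' - v‖ ^ 2 + (t' - t) ^ 2 * ‖u - v‖ ^ 2) := by rw [mul_pow, sq_abs]

/-! ## §2 ★★★ B2′ — the lattice Luckhaus lemma for `S³`-valued maps (Hardt–Kinderlehrer–Lin form) -/

/-- ★★★ **B2′ — THE LATTICE LUCKHAUS LEMMA FOR `S³`-VALUED MAPS, GEOMETRY-FREE.**  There is a universal `C ≥ 0` such that for all unit lattice maps
`u v : ℤ³ → S³ ⊂ ℝ⁴`, every cutoff `t : ℤ³ → [0, 1]` and every finite set `T` of bonds `(y, μ)` (from `y` to `y + e_μ`) there is a UNIT lattice map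
`w` with `w = u` wherever `t = 0`, `w = v` wherever `t = 1`, and
`Σ_T ‖w(y+e_μ) − w y‖² ≤ C·Σ_T (‖u(y+e_μ) − u y‖² + ‖v(y+e_μ) − v y‖² + (t(y+e_μ) − t y)²·‖u y − v y‖²)`.
Construction: `w := π_p ∘ ((1 − t)u + t v)` with `π_p` the ray projection from a centre `‖p‖ < ½` off the range of the interpolant (H-1), `p` chosen by
the average of H-2 with weights `‖δw̃‖²` at the points `w̃(y)`; `C = 108·K`.  No annulus geometry, no skeleton, no smallness proviso.
[cite: HardtKinderlehrerLin1986, §2] -/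
theorem exists_unit_interpolant : ∃ C : ℝ, 0 ≤ C ∧
    ∀ (u v : Zd 3 → EuclideanSpace ℝ (Fin 4)) (t : Zd 3 → ℝ),
      (∀ y, ‖u y‖ = 1) → (∀ y, ‖v y‖ = 1) → (∀ y, 0 ≤ t y) → (∀ y, t y ≤ 1) →
      ∀ T : Finset (Zd 3 × Fin 3),
        ∃ w : Zd 3 → EuclideanSpace ℝ (Fin 4),
          (∀ y, ‖w y‖ = 1) ∧ (∀ y, t y = 0 → w y = u y) ∧ (∀ y, t y = 1 → w y = v y) ∧
          ∑ e ∈ T, ‖w (e.1 + unitVec e.2) - w e.1‖ ^ 2 ≤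
            C * ∑ e ∈ T, (‖u (e.1 + unitVec e.2) - u e.1‖ ^ 2 + ‖v (e.1 + unitVec e.2) - v e.1‖ ^ 2 +
              (t (e.1 + unitVec e.2) - t e.1) ^ 2 * ‖u e.1 - v e.1‖ ^ 2) := by
  classical
  obtain ⟨K, hK0, hK⟩ := exists_centre_weighted_le.{0}
  refine ⟨108 * K, by positivity, ?_⟩
  intro u v t hu hv ht0 ht1 T
  -- the linear interpolant and its range
  set wt : Zd 3 → EuclideanSpace ℝ (Fin 4) := fun y => (1 - t y) • u y + t y • v y with hwt
  have hwt1 : ∀ y, ‖wt y‖ ≤ 1 := fun y => norm_convex_le_one (u y) (v y) (t y) (hu y) (hv y) (ht0 y) (ht1 y)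
  have hN : (Set.range wt).Countable := Set.countable_range wt
  -- the averaged centre, off the range of the interpolant
  obtain ⟨p, hp, hpN, hsum⟩ := hK (Zd 3 × Fin 3) T (fun e => ‖wt (e.1 + unitVec e.2) - wt e.1‖ ^ 2) (fun e => wt e.1)
    (Set.range wt) (fun e _ => by positivity) (fun e _ => hwt1 e.1) hN
  have hne : ∀ y, wt y ≠ p := fun y h => hpN ⟨y, h⟩
  have hp' : ‖p‖ ≤ 1 / 2 := hp.le
  -- the ray projection from `p`, written out
  set π : EuclideanSpace ℝ (Fin 4) → EuclideanSpace ℝ (Fin 4) := fun x =>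
    p + (-⟪p, ‖x - p‖⁻¹ • (x - p)⟫ + Real.sqrt (⟪p, ‖x - p‖⁻¹ • (x - p)⟫ ^ 2 + (1 - ‖p‖ ^ 2))) •
      (‖x - p‖⁻¹ • (x - p)) with hπ
  refine ⟨fun y => π (wt y), fun y => ?_, fun y hy => ?_, fun y hy => ?_, ?_⟩
  · -- unit
    exact norm_rayProj_eq_one p (wt y) hp' (hne y)
  · -- `t y = 0`: `w̃ y = u y`, fixed by the projection
    have hwy : wt y = u y := by simp only [hwt, hy, sub_zero, one_smul, zero_smul, add_zero]
    simp only [hπ, hwy]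
    exact rayProj_eq_self_of_norm_eq_one p (u y) hp' (hu y)
  · -- `t y = 1`: `w̃ y = v y`
    have hwy : wt y = v y := by simp only [hwt, hy, sub_self, zero_smul, one_smul, zero_add]
    simp only [hπ, hwy]
    exact rayProj_eq_self_of_norm_eq_one p (v y) hp' (hv y)
  · -- energy: bond by bond `‖δ(π ∘ w̃)‖² ≤ 36‖δw̃‖²∕‖w̃(y) − p‖²`, then the average, then the factor 3
    have hbond : ∀ e ∈ T, ‖π (wt (e.1 + unitVec e.2)) - π (wt e.1)‖ ^ 2 ≤
        36 * (‖wt (e.1 + unitVec e.2) - wt e.1‖ ^ 2 * (‖wt e.1 - p‖ ^ 2)⁻¹) := by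
      intro e _
      have h := norm_rayProj_sub_rayProj_sq_le p (wt e.1) (wt (e.1 + unitVec e.2)) hp' (hne e.1) (hne _)
      rw [norm_sub_rev (wt e.1) (wt (e.1 + unitVec e.2)), div_eq_mul_inv, mul_assoc] at h
      calc ‖π (wt (e.1 + unitVec e.2)) - π (wt e.1)‖ ^ 2 = ‖π (wt e.1) - π (wt (e.1 + unitVec e.2))‖ ^ 2 := by
            rw [norm_sub_rev]
        _ ≤ _ := h
    have hwt3 : ∀ e ∈ T, ‖wt (e.1 + unitVec e.2) - wt e.1‖ ^ 2 ≤
        3 * (‖u (e.1 + unitVec e.2) - u e.1‖ ^ 2 + ‖v (e.1 + unitVec e.2) - v e.1‖ ^ 2 +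
          (t (e.1 + unitVec e.2) - t e.1) ^ 2 * ‖u e.1 - v e.1‖ ^ 2) := by
      intro e _
      exact norm_sub_sq_convex_le (u e.1) (u (e.1 + unitVec e.2)) (v e.1) (v (e.1 + unitVec e.2)) (t e.1)
        (t (e.1 + unitVec e.2)) (ht0 _) (ht1 _)
    calc ∑ e ∈ T, ‖π (wt (e.1 + unitVec e.2)) - π (wt e.1)‖ ^ 2
        ≤ ∑ e ∈ T, 36 * (‖wt (e.1 + unitVec e.2) - wt e.1‖ ^ 2 * (‖wt e.1 - p‖ ^ 2)⁻¹) := Finset.sum_le_sum hbond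
      _ = 36 * ∑ e ∈ T, ‖wt (e.1 + unitVec e.2) - wt e.1‖ ^ 2 * (‖wt e.1 - p‖ ^ 2)⁻¹ := by rw [Finset.mul_sum]
      _ ≤ 36 * (K * ∑ e ∈ T, ‖wt (e.1 + unitVec e.2) - wt e.1‖ ^ 2) := mul_le_mul_of_nonneg_left hsum (by norm_num)
      _ ≤ 36 * (K * ∑ e ∈ T, 3 * (‖u (e.1 + unitVec e.2) - u e.1‖ ^ 2 + ‖v (e.1 + unitVec e.2) - v e.1‖ ^ 2 +
            (t (e.1 + unitVec e.2) - t e.1) ^ 2 * ‖u e.1 - v e.1‖ ^ 2)) :=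
          mul_le_mul_of_nonneg_left (mul_le_mul_of_nonneg_left (Finset.sum_le_sum hwt3) hK0) (by norm_num)
      _ = 108 * K * ∑ e ∈ T, (‖u (e.1 + unitVec e.2) - u e.1‖ ^ 2 + ‖v (e.1 + unitVec e.2) - v e.1‖ ^ 2 +
            (t (e.1 + unitVec e.2) - t e.1) ^ 2 * ‖u e.1 - v e.1‖ ^ 2) := by rw [← Finset.mul_sum]; ring

end Summit.QuantumFields.YangMills.Theorems.PoincareLipschitzLatticeLuckhausHKL

end
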